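import Literature.Analysis.Complex.ConformalRadiusBoundary
import Literature.Analysis.Complex.SimplyConnectedOfCompl
import HarnessLib

/-!
# The conformal radius of a union: LSW's chain rule (2.7)–(2.8) (proofs only)

Def-free sequel of `ConformalRadius.lean` (the extremal conformal radius
`Literature.Analysis.Complex.conformalRadius K` about `0` of the component `U_K` of `0` in
`𝔻 ∖ K`, `𝔻 = ball 0 1`) and `ConformalRadiusBoundary.lean` (LSW's (2.16)). In the proof of
Lemma 2.2 of Lawler–Schramm–Werner, *One-arm exponent for critical 2D percolation*, Electron.
J. Probab. **7** (2002), no. 2 (p. 5), `𝔯(θ)` is computed by first removing the hull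
`γ[0, T]` (conformal radius `e^{-T}`, (2.6)) and then, inside the remaining component `W'`,
the copy of `Q(2π)` transported by the normalised map `ψ_{W'}`: (2.7) "`𝔯(θ) = e^{-T}` if
`ν = -1`", (2.8) "by the chain rule for the derivative at zero, `𝔯(θ) = r' e^{-T}` if
`ν = 1`"; the same multiplicativity opens the proof of Lemma 2.3 (p. 7):
"`min{log 𝔯(θ) - log 𝔯(2π), 1} = min{-log 𝔯(ψ_θ(Q')), 1}`", `Q' = Q(2π) ∖ Q(θ)`. We prove
this deterministic step for the tree's `conformalRadius` and an ARBITRARY second set `L`: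

* `conformalRadius_union_eq_inv_norm_deriv_mul`, `conformalRadius_union_eq_mul` — **the chain
  rule**: for closed `K` and a holomorphic bijection `ψ : U_K → 𝔻`, `ψ(0) = 0`, with
  holomorphic inverse (the hypotheses of `conformalRadius_eq_inv_norm_deriv`, the case
  `L = ∅`), `𝔯(K ∪ L) = |ψ'(0)|⁻¹ 𝔯(ψ(L ∩ U_K)) = 𝔯(K) 𝔯(ψ(L ∩ U_K))`; for `K ⊆ K'` (LSW's
  `Q(θ) ⊆ Q(2π)`) `𝔯(K') = 𝔯(K) 𝔯(ψ(K' ∩ U_K))` and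
  `log 𝔯(K) - log 𝔯(K') = -log 𝔯(ψ(K' ∩ U_K))`. Proof: `φ ↦ ψ ∘ φ` and `g ↦ ψ⁻¹ ∘ g`
  exchange the admissible univalent maps of `K ∪ L` and of `ψ(L ∩ U_K)` (an admissible `φ`
  lands in `U_K`, `IsUnivalentInto.mapsTo_connectedComponentIn`), scaling `|·'(0)|` by
  `|ψ'(0)|`;
* `conformalRadius_union_eq_of_disjoint` — (2.7): `𝔯(K ∪ L) = 𝔯(K)` if `L` misses `U_K`
  (no map, no closedness needed); `conformalRadius_empty : 𝔯(∅) = 1`;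
* `log_conformalRadius_sub_log_le_of_image_subset_closedBall` — the chain rule composed with
  (2.16) (`neg_log_conformalRadius_le_of_subset_closedBall`): if `ψ(K' ∩ U_K) ⊆ B̄(ζ, ε)`,
  `|ζ| = 1`, `0 < ε ≤ 1/2`, then `0 ≤ log 𝔯(K) - log 𝔯(K') ≤ 3ε²` — the form in which Lemma
  2.3 consumes (2.15)–(2.16) once `ψ_θ(Q')` is localised near `∂𝕌`;
* `not_isBounded_connectedComponentIn_compl`, `exists_bijOn_connectedComponentIn`,
  `exists_conformalRadius_union_eq_mul` — EXISTENCE of `ψ` for LSW's sets: if `K ∌ 0` is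
  closed and `(ball 0 1)ᶜ ∪ K` is connected (every point of `K` joined to `∂𝔻` inside `K ∪ ∂𝔻`,
  as for `Q(θ) ⊇ A_θ`, a union of clusters meeting the arc), then `U_K` has no holes, hence
  the square-root property (`Complex.hasSqrt_of_compl`, Conway VIII.2.2) and a normalised
  Riemann map (`Complex.exists_bijOn_ball_of_hasSqrt`).

Not here: the Loewner identification `𝔯(𝕌 ∖ γ[0,T]) = e^{-T}` ((2.6)), harmonic measure and
the localisation (2.15). No new definitions, no named facts.

## References

* G. F. Lawler, O. Schramm, W. Werner, *One-arm exponent for critical 2D percolation*,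
  Electron. J. Probab. 7 (2002), no. 2, §2: (2.6)–(2.8) (p. 5), proof of Lemma 2.3 (p. 7)
  [LawlerSchrammWernerEJP2002].
* J. B. Conway, *Functions of One Complex Variable I*, 2nd ed. (1978), Thm. VIII.2.2
  [Conway1978].

## Mathlib / tree

Tree: `conformalRadius`, `IsUnivalentInto`, `conformalRadius_le`,
`conformalRadius_eq_inv_norm_deriv` (`ConformalRadius.lean`);
`le_conformalRadius_of_subset_closedBall`, `neg_log_conformalRadius_le_of_subset_closedBall`
(`ConformalRadiusBoundary.lean`); `Complex.hasSqrt_of_compl`,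
`Complex.exists_bijOn_ball_of_hasSqrt`. Mathlib: `connectedComponentIn` API
(`IsPreconnected.subset_connectedComponentIn`, `connectedComponentIn_eq`,
`IsOpen.connectedComponentIn`), `IsClopen.eq_univ`, `Disjoint.closure_left`, `HasDerivAt.comp`.
-/

noncomputable section

open Metric Set Filter Function Bornology
open _root_.Topology

namespace Literature.Analysis.Complex

variable {K : Set ℂ}

/-! ### Bookkeeping: `𝔯(∅) = 1`, sets missing `U_K` -/

/-- The conformal radius of the full disc is `1` (the identity is admissible; `≤ 1` is the
Schwarz lemma, `conformalRadius_le_one`). [folklore] -/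
theorem conformalRadius_empty : conformalRadius (∅ : Set ℂ) = 1 := by
  refine le_antisymm (conformalRadius_le_one _) ?_
  have h : IsUnivalentInto (∅ : Set ℂ) (fun z ↦ z) :=
    ⟨differentiableOn_id, injOn_id _, rfl, fun z hz ↦ ⟨hz, fun h ↦ h⟩⟩
  simpa using h.norm_deriv_le_conformalRadius

/-- **LSW's (2.7)**: a set `L` that misses the component `U_K` of `0` in `𝔻 ∖ K` does not change
the conformal radius about `0`: `𝔯(K ∪ L) = 𝔯(K)` (admissible maps for `K` land in `U_K`). In
LSW's proof of Lemma 2.2 this is the case `ν = -1`, where `Q(θ)` does not enter the component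
`W'` of `0`. [cite: LawlerSchrammWernerEJP2002, §2 (2.7) (p. 5)] -/
theorem conformalRadius_union_eq_of_disjoint {L : Set ℂ}
    (hL : Disjoint L (connectedComponentIn (ball 0 1 \ K) 0)) :
    conformalRadius (K ∪ L) = conformalRadius K := by
  refine le_antisymm (conformalRadius_mono subset_union_left) ?_
  refine conformalRadius_le (conformalRadius_nonneg _) fun φ hφ ↦ ?_
  have hφ' : IsUnivalentInto (K ∪ L) φ := by
    refine ⟨hφ.differentiableOn, hφ.injOn, hφ.map_zero, fun z hz ↦ ⟨(hφ.mapsTo hz).1, ?_⟩⟩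
    rintro (hzK | hzL)
    · exact (hφ.mapsTo hz).2 hzK
    · exact hL.le_bot ⟨hzL, hφ.mapsTo_connectedComponentIn hz⟩
  exact hφ'.norm_deriv_le_conformalRadius

/-! ### The normalised map of `U_K`: inverse and derivative at `0` -/

section Map

variable {ψ : ℂ → ℂ} (hK : IsClosed K)
  (hψ : DifferentiableOn ℂ ψ (connectedComponentIn (ball 0 1 \ K) 0))
  (hbij : BijOn ψ (connectedComponentIn (ball 0 1 \ K) 0) (ball 0 1)) (hψ0 : ψ 0 = 0)
  (hinv : DifferentiableOn ℂ (invFunOn ψ (connectedComponentIn (ball 0 1 \ K) 0)) (ball 0 1))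
include hK hψ hbij hψ0 hinv

/-- For a holomorphic bijection `ψ : U_K → 𝔻` with `ψ(0) = 0` and holomorphic inverse:
`0 ∈ U_K`, the inverse fixes `0`, is a right inverse on `𝔻` with values in `U_K`, and
`ψ'(0) · (ψ⁻¹)'(0) = 1`. [folklore] -/
theorem invFunOn_spec_of_bijOn :
    (0 : ℂ) ∈ connectedComponentIn (ball 0 1 \ K) 0 ∧
      invFunOn ψ (connectedComponentIn (ball 0 1 \ K) 0) 0 = 0 ∧
      (∀ b ∈ ball (0 : ℂ) 1, ψ (invFunOn ψ (connectedComponentIn (ball 0 1 \ K) 0) b) = b) ∧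
      (∀ b ∈ ball (0 : ℂ) 1, invFunOn ψ (connectedComponentIn (ball 0 1 \ K) 0) b ∈
        connectedComponentIn (ball 0 1 \ K) 0) ∧
      HasDerivAt ψ (deriv ψ 0) 0 ∧
      HasDerivAt (invFunOn ψ (connectedComponentIn (ball 0 1 \ K) 0))
        (deriv (invFunOn ψ (connectedComponentIn (ball 0 1 \ K) 0)) 0) 0 ∧
      deriv ψ 0 * deriv (invFunOn ψ (connectedComponentIn (ball 0 1 \ K) 0)) 0 = 1 := by
  set U := connectedComponentIn (ball 0 1 \ K) 0 with hU
  set finv := invFunOn ψ U with hfinv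
  have hUopen : IsOpen U := (isOpen_ball.sdiff hK).connectedComponentIn
  have h0U : (0 : ℂ) ∈ U := by
    by_contra h0
    have := hbij.surjOn (mem_ball_self (x := (0 : ℂ)) one_pos)
    rw [hU, connectedComponentIn_eq_empty fun h0' ↦ h0 (mem_connectedComponentIn h0'),
      image_empty] at this
    exact this
  have hsurj : ∀ b ∈ ball (0 : ℂ) 1, ∃ a ∈ U, ψ a = b := fun b hb ↦ hbij.surjOn hb
  have hψfinv : ∀ b ∈ ball (0 : ℂ) 1, ψ (finv b) = b := fun b hb ↦ invFunOn_eq (hsurj b hb)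
  have hfinvU : ∀ b ∈ ball (0 : ℂ) 1, finv b ∈ U := fun b hb ↦ invFunOn_mem (hsurj b hb)
  have hfinv0 : finv 0 = 0 := by
    have := hbij.injOn.leftInvOn_invFunOn h0U
    rwa [hψ0] at this
  have hdψ : HasDerivAt ψ (deriv ψ 0) 0 := (hψ.differentiableAt (hUopen.mem_nhds h0U)).hasDerivAt
  have hdfinv : HasDerivAt finv (deriv finv 0) 0 :=
    (hinv.differentiableAt (ball_mem_nhds 0 one_pos)).hasDerivAt
  have hchain : HasDerivAt (fun z ↦ ψ (finv z)) (deriv ψ 0 * deriv finv 0) 0 := by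
    have hψ' : HasDerivAt ψ (deriv ψ 0) (finv 0) := by rw [hfinv0]; exact hdψ
    exact hψ'.comp 0 hdfinv
  have hid : HasDerivAt (fun z : ℂ ↦ z) (deriv ψ 0 * deriv finv 0) 0 :=
    hchain.congr_of_eventuallyEq (by
      filter_upwards [ball_mem_nhds (0 : ℂ) one_pos] with z hz
      exact (hψfinv z hz).symm)
  exact ⟨h0U, hfinv0, hψfinv, hfinvU, hdψ, hdfinv, hid.unique (hasDerivAt_id 0)⟩

/-- The derivative at `0` of a holomorphic bijection `U_K → 𝔻` fixing `0` with holomorphic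
inverse is nonzero. [folklore] -/
theorem deriv_ne_zero_of_bijOn_connectedComponentIn : deriv ψ 0 ≠ 0 :=
  left_ne_zero_of_mul_eq_one (invFunOn_spec_of_bijOn hK hψ hbij hψ0 hinv).2.2.2.2.2.2

/-- With a normalised Riemann map of `U_K` at hand, `𝔯(K) = 1/|ψ'(0)| > 0`. [folklore] -/
theorem conformalRadius_pos_of_bijOn : 0 < conformalRadius K := by
  rw [conformalRadius_eq_inv_norm_deriv hK hψ hbij hψ0 hinv]
  exact inv_pos.2 (norm_pos_iff.2 (deriv_ne_zero_of_bijOn_connectedComponentIn hK hψ hbij hψ0 hinv))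

/-! ### The chain rule -/

/-- **LSW's chain rule (2.8) for the extremal conformal radius.** Let `K` be closed, `U_K` the
component of `0` in `𝔻 ∖ K`, and `ψ : U_K → 𝔻` a holomorphic bijection with `ψ(0) = 0` and
holomorphic inverse. Then for every `L ⊆ ℂ`,
`𝔯(K ∪ L) = |ψ'(0)|⁻¹ · 𝔯(ψ(L ∩ U_K))`: removing `L` from `U_K` and transporting by `ψ`
multiplies conformal radii ("by the chain rule for the derivative at zero, `𝔯(θ) = r' e^{-T}`").
Proof: `φ ↦ ψ ∘ φ` and `g ↦ ψ⁻¹ ∘ g` exchange the admissible maps of `K ∪ L` and of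
`ψ(L ∩ U_K)`, scaling `|·'(0)|` by `|ψ'(0)|`. [cite: LawlerSchrammWernerEJP2002, §2 (2.8) (p. 5)] -/
theorem conformalRadius_union_eq_inv_norm_deriv_mul (L : Set ℂ) :
    conformalRadius (K ∪ L) =
      ‖deriv ψ 0‖⁻¹ * conformalRadius (ψ '' (L ∩ connectedComponentIn (ball 0 1 \ K) 0)) := by
  obtain ⟨h0U, hfinv0, hψfinv, hfinvU, hdψ, hdfinv, hone⟩ :=
    invFunOn_spec_of_bijOn hK hψ hbij hψ0 hinv
  set U := connectedComponentIn (ball 0 1 \ K) 0 with hU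
  set finv := invFunOn ψ U with hfinv
  have hUsub : U ⊆ ball 0 1 \ K := connectedComponentIn_subset _ _
  have hψ'ne : deriv ψ 0 ≠ 0 := left_ne_zero_of_mul_eq_one hone
  have hfinv' : deriv finv 0 = (deriv ψ 0)⁻¹ := eq_inv_of_mul_eq_one_right hone
  have hpos : 0 < ‖deriv ψ 0‖ := norm_pos_iff.2 hψ'ne
  refine le_antisymm ?_ ?_
  · -- admissible `φ` for `K ∪ L` ↦ `ψ ∘ φ`, admissible for `ψ '' (L ∩ U)`
    refine conformalRadius_le (mul_nonneg (inv_nonneg.2 (norm_nonneg _)) (conformalRadius_nonneg _))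
      fun φ hφ ↦ ?_
    have hφK : IsUnivalentInto K φ := hφ.mono subset_union_left
    have hφU : MapsTo φ (ball 0 1) U := hφK.mapsTo_connectedComponentIn
    have hg : IsUnivalentInto (ψ '' (L ∩ U)) (fun z ↦ ψ (φ z)) := by
      refine ⟨hψ.comp hφ.differentiableOn hφU, ?_, by rw [hφ.map_zero, hψ0], ?_⟩
      · intro z hz z' hz' heq
        exact hφ.injOn hz hz' (hbij.injOn (hφU hz) (hφU hz') heq)
      · intro z hz
        refine ⟨hbij.mapsTo (hφU hz), ?_⟩
        rintro ⟨w, ⟨hwL, hwU⟩, hw⟩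
        have hw' : w = φ z := hbij.injOn hwU (hφU hz) hw
        exact (hφ.mapsTo hz).2 (Or.inr (hw' ▸ hwL))
    have hle := hg.norm_deriv_le_conformalRadius
    have hdφ : HasDerivAt φ (deriv φ 0) 0 :=
      (hφ.differentiableOn.differentiableAt (ball_mem_nhds 0 one_pos)).hasDerivAt
    have hch : HasDerivAt (fun z ↦ ψ (φ z)) (deriv ψ 0 * deriv φ 0) 0 := by
      have hψ' : HasDerivAt ψ (deriv ψ 0) (φ 0) := by rw [hφ.map_zero]; exact hdψ
      exact hψ'.comp 0 hdφ
    rw [hch.deriv, norm_mul] at hle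
    rwa [le_inv_mul_iff₀ hpos]
  · -- admissible `g` for `ψ '' (L ∩ U)` ↦ `ψ⁻¹ ∘ g`, admissible for `K ∪ L`
    rw [inv_mul_le_iff₀ hpos]
    refine conformalRadius_le (mul_nonneg (norm_nonneg _) (conformalRadius_nonneg _)) fun g hg ↦ ?_
    have hgball : MapsTo g (ball 0 1) (ball 0 1) := hg.mapsTo_ball
    have hφ : IsUnivalentInto (K ∪ L) (fun z ↦ finv (g z)) := by
      refine ⟨hinv.comp hg.differentiableOn hgball, ?_, by rw [hg.map_zero, hfinv0], ?_⟩
      · intro z hz z' hz' heq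
        have heq' := congrArg ψ heq
        simp only at heq'
        rw [hψfinv _ (hgball hz), hψfinv _ (hgball hz')] at heq'
        exact hg.injOn hz hz' heq'
      · intro z hz
        have hgz := hgball hz
        refine ⟨(hUsub (hfinvU _ hgz)).1, ?_⟩
        rintro (hKmem | hLmem)
        · exact (hUsub (hfinvU _ hgz)).2 hKmem
        · exact (hg.mapsTo hz).2 ⟨finv (g z), ⟨hLmem, hfinvU _ hgz⟩, hψfinv _ hgz⟩
    have hle := hφ.norm_deriv_le_conformalRadius
    have hdg : HasDerivAt g (deriv g 0) 0 :=
      (hg.differentiableOn.differentiableAt (ball_mem_nhds 0 one_pos)).hasDerivAt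
    have hch : HasDerivAt (fun z ↦ finv (g z)) (deriv finv 0 * deriv g 0) 0 := by
      have h' : HasDerivAt finv (deriv finv 0) (g 0) := by rw [hg.map_zero]; exact hdfinv
      exact h'.comp 0 hdg
    rw [hch.deriv, norm_mul, hfinv', norm_inv, inv_mul_le_iff₀ hpos] at hle
    exact hle

/-- **LSW's chain rule (2.8), multiplicative form**: `𝔯(K ∪ L) = 𝔯(K) · 𝔯(ψ(L ∩ U_K))`
(`conformalRadius_union_eq_inv_norm_deriv_mul` with `𝔯(K) = 1/|ψ'(0)|`,
`conformalRadius_eq_inv_norm_deriv`). [cite: LawlerSchrammWernerEJP2002, §2 (2.8) (p. 5)] -/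
theorem conformalRadius_union_eq_mul (L : Set ℂ) :
    conformalRadius (K ∪ L) =
      conformalRadius K * conformalRadius (ψ '' (L ∩ connectedComponentIn (ball 0 1 \ K) 0)) := by
  rw [conformalRadius_union_eq_inv_norm_deriv_mul hK hψ hbij hψ0 hinv L,
    conformalRadius_eq_inv_norm_deriv hK hψ hbij hψ0 hinv]

/-- **Monotone form** (LSW's `Q(θ) ⊆ Q(2π)`, proof of Lemma 2.3, p. 7): for `K ⊆ K'`,
`𝔯(K') = 𝔯(K) · 𝔯(ψ(K' ∩ U_K))`.
[cite: LawlerSchrammWernerEJP2002, §2, proof of Lemma 2.3 (p. 7)] -/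
theorem conformalRadius_eq_mul_of_subset {K' : Set ℂ} (hKK' : K ⊆ K') :
    conformalRadius K' =
      conformalRadius K * conformalRadius (ψ '' (K' ∩ connectedComponentIn (ball 0 1 \ K) 0)) := by
  have h := conformalRadius_union_eq_mul hK hψ hbij hψ0 hinv K'
  rwa [union_eq_self_of_subset_left hKK'] at h

/-- **Logarithmic form** ("`log 𝔯(θ) - log 𝔯(2π) = -log 𝔯(ψ_θ(Q'))`", LSW p. 7): for `K ⊆ K'`
with `𝔯(K') ≠ 0`, `log 𝔯(K) - log 𝔯(K') = -log 𝔯(ψ(K' ∩ U_K))`.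
[cite: LawlerSchrammWernerEJP2002, §2, proof of Lemma 2.3 (p. 7)] -/
theorem log_conformalRadius_sub_log_conformalRadius {K' : Set ℂ} (hKK' : K ⊆ K')
    (hK'0 : conformalRadius K' ≠ 0) :
    Real.log (conformalRadius K) - Real.log (conformalRadius K') =
      -Real.log (conformalRadius (ψ '' (K' ∩ connectedComponentIn (ball 0 1 \ K) 0))) := by
  have hprod := conformalRadius_eq_mul_of_subset hK hψ hbij hψ0 hinv hKK'
  have hM0 : conformalRadius (ψ '' (K' ∩ connectedComponentIn (ball 0 1 \ K) 0)) ≠ 0 :=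
    fun h ↦ hK'0 (by rw [hprod, h, mul_zero])
  have hK0 : conformalRadius K ≠ 0 := fun h ↦ hK'0 (by rw [hprod, h, zero_mul])
  rw [hprod, Real.log_mul hK0 hM0]
  ring

/-- **The chain rule composed with LSW's (2.16).** If `K ⊆ K'` and the transported difference
`ψ(K' ∩ U_K)` lies in a closed disc `B̄(ζ, ε)` centred on the unit circle with
`0 < ε ≤ 1/2`, then `0 ≤ log 𝔯(K) - log 𝔯(K') ≤ 3ε²`
(`neg_log_conformalRadius_le_of_subset_closedBall`). This is the deterministic skeleton of
LSW's proof of Lemma 2.3 (p. 7) downstream of the localisation step (2.15).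
[cite: LawlerSchrammWernerEJP2002, §2 (2.16) and proof of Lemma 2.3 (pp. 6–7)] -/
theorem log_conformalRadius_sub_log_le_of_image_subset_closedBall {K' : Set ℂ}
    (hKK' : K ⊆ K') {ζ : ℂ} (hζ : ‖ζ‖ = 1) {ε : ℝ} (hε0 : 0 < ε) (hε : ε ≤ 1 / 2)
    (hsub : ψ '' (K' ∩ connectedComponentIn (ball 0 1 \ K) 0) ⊆ closedBall ζ ε) :
    0 ≤ Real.log (conformalRadius K) - Real.log (conformalRadius K') ∧
      Real.log (conformalRadius K) - Real.log (conformalRadius K') ≤ 3 * ε ^ 2 := by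
  set M := ψ '' (K' ∩ connectedComponentIn (ball 0 1 \ K) 0) with hM
  have hMpos : 0 < conformalRadius M := by
    refine lt_of_lt_of_le ?_ (le_conformalRadius_of_subset_closedBall hζ hε0 hsub)
    have hε2 : ε ^ 2 < 1 := by nlinarith
    exact div_pos (by linarith) (by positivity)
  have hKpos : 0 < conformalRadius K := conformalRadius_pos_of_bijOn hK hψ hbij hψ0 hinv
  have hprod := conformalRadius_eq_mul_of_subset hK hψ hbij hψ0 hinv hKK'
  have hK'pos : 0 < conformalRadius K' := by rw [hprod]; exact mul_pos hKpos hMpos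
  rw [log_conformalRadius_sub_log_conformalRadius hK hψ hbij hψ0 hinv hKK' hK'pos.ne']
  exact ⟨neg_nonneg.2 (Real.log_nonpos hMpos.le (conformalRadius_le_one _)),
    neg_log_conformalRadius_le_of_subset_closedBall hζ hε0 hε hsub⟩

end Map

/-! ### Existence of the normalised map for sets joined to the circle -/

/-- **The component of `0` has no holes.** If `(ball 0 1)ᶜ ∪ K` is preconnected (e.g. `K ⊇ ∂𝔻`
with every point of `K` joined to `∂𝔻` inside `K`, as for LSW's `Q(θ) ⊇ A_θ`), `K` is closed,
and `U_K` is the component of `0` in `𝔻 ∖ K`, then every connected component of `U_Kᶜ` is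
unbounded: a component of `U_Kᶜ` either meets the connected unbounded set `(ball 0 1)ᶜ ∪ K`
directly, or contains another component `V` of `𝔻 ∖ K`, whose closure meets `(ball 0 1)ᶜ ∪ K`
(otherwise `V` would be clopen in `ℂ`). [folklore] -/
theorem not_isBounded_connectedComponentIn_compl (hK : IsClosed K)
    (hconn : IsPreconnected ((ball (0 : ℂ) 1)ᶜ ∪ K)) {a : ℂ}
    (ha : a ∈ (connectedComponentIn (ball 0 1 \ K) 0)ᶜ) :
    ¬ IsBounded (connectedComponentIn (connectedComponentIn (ball 0 1 \ K) 0)ᶜ a) := by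
  set S : Set ℂ := (ball (0 : ℂ) 1)ᶜ ∪ K with hS
  set U := connectedComponentIn (ball 0 1 \ K) 0 with hU
  have hSc : Sᶜ = ball 0 1 \ K := by
    ext z
    constructor
    · intro hz
      exact ⟨by_contra fun h ↦ hz (Or.inl h), fun h ↦ hz (Or.inr h)⟩
    · rintro ⟨hzb, hzK⟩ (h | h)
      exacts [h hzb, hzK h]
  have hUopen : IsOpen U := (isOpen_ball.sdiff hK).connectedComponentIn
  have hUsubSc : U ⊆ Sᶜ := hSc ▸ connectedComponentIn_subset _ _
  have hSU : S ⊆ Uᶜ := subset_compl_comm.1 hUsubSc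
  -- `S` is unbounded
  have hSunb : ¬ IsBounded S := by
    intro hb
    obtain ⟨r, hr⟩ := (isBounded_iff_subset_closedBall 0).1 hb
    have hnorm : ‖((max r 0 + 1 : ℝ) : ℂ)‖ = max r 0 + 1 := by
      rw [Complex.norm_real, Real.norm_eq_abs, abs_of_nonneg (by positivity)]
    have hmem : ((max r 0 + 1 : ℝ) : ℂ) ∈ S :=
      Or.inl (by rw [mem_compl_iff, mem_ball_zero_iff, hnorm]; linarith [le_max_right r 0])
    have := mem_closedBall_zero_iff.1 (hr hmem)
    linarith [le_max_left r 0]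
  -- it suffices to find a point of `S` in the component of `a`
  suffices h : ∃ x ∈ S, x ∈ connectedComponentIn Uᶜ a by
    obtain ⟨x, hxS, hxC⟩ := h
    refine fun hb ↦ hSunb (hb.subset ?_)
    rw [connectedComponentIn_eq hxC]
    exact hconn.subset_connectedComponentIn hxS hSU
  by_cases haS : a ∈ S
  · exact ⟨a, haS, mem_connectedComponentIn ha⟩
  · -- `a` lies in another component `V` of the open set `Sᶜ`
    have haSc : a ∈ Sᶜ := haS
    set V := connectedComponentIn Sᶜ a with hV
    have hVopen : IsOpen V := (hSc ▸ isOpen_ball.sdiff hK).connectedComponentIn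
    have haV : a ∈ V := mem_connectedComponentIn haSc
    have hVU : Disjoint V U := by
      refine disjoint_left.2 fun y hyV hyU ↦ ha ?_
      have h2 : connectedComponentIn Sᶜ (0 : ℂ) = connectedComponentIn Sᶜ y :=
        connectedComponentIn_eq (by rw [hSc]; exact hyU)
      rw [hU, ← hSc, h2, ← connectedComponentIn_eq hyV]
      exact haV
    -- the closure of `V` meets `S`
    have hclS : ∃ x ∈ closure V, x ∈ S := by
      by_contra hcon
      have hclSc : closure V ⊆ Sᶜ := fun x hx hxS ↦ hcon ⟨x, hx, hxS⟩
      have hclV : closure V ⊆ V :=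
        (isPreconnected_connectedComponentIn.closure).subset_connectedComponentIn
          (subset_closure haV) hclSc
      have hVclosed : IsClosed V := closure_subset_iff_isClosed.1 hclV
      have hVuniv : V = univ := IsClopen.eq_univ ⟨hVclosed, hVopen⟩ ⟨a, haV⟩
      have hVS : V ⊆ Sᶜ := connectedComponentIn_subset _ _
      have hSempty : S = ∅ :=
        eq_empty_of_forall_notMem fun x hxS ↦ hVS (hVuniv ▸ mem_univ x) hxS
      exact hSunb (hSempty ▸ isBounded_empty)
    obtain ⟨x, hxcl, hxS⟩ := hclS
    -- `closure V ⊆ Uᶜ` (as `U` is open) is preconnected and contains `a`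
    exact ⟨x, hxS, (isPreconnected_connectedComponentIn.closure).subset_connectedComponentIn
      (subset_closure haV) (subset_compl_iff_disjoint_right.2 (hVU.closure_left hUopen)) hxcl⟩

/-- **A normalised Riemann map of the component of `0` exists** for closed `K ∌ 0` with
`(ball 0 1)ᶜ ∪ K` preconnected (LSW's sets `Q(θ)`: "Let `ψ = ψ_θ : U(θ) → 𝕌` be the conformal
map, normalized by `ψ(0) = 0` and `ψ'(0) > 0`", p. 4 — here without the rotation normalisation,
which the conformal radius does not see): `U_K` is open, connected, hole-free
(`not_isBounded_connectedComponentIn_compl`), so it has the square-root property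
(`Complex.hasSqrt_of_compl`) and the Riemann mapping theorem applies
(`Complex.exists_bijOn_ball_of_hasSqrt`). [cite: LawlerSchrammWernerEJP2002, §2 (p. 4)]
[cite: Conway1978, Ch. VIII Thm. 2.2, Ch. VII Thm. 4.2] -/
theorem exists_bijOn_connectedComponentIn (hK : IsClosed K) (h0 : (0 : ℂ) ∉ K)
    (hconn : IsPreconnected ((ball (0 : ℂ) 1)ᶜ ∪ K)) :
    ∃ ψ : ℂ → ℂ, DifferentiableOn ℂ ψ (connectedComponentIn (ball 0 1 \ K) 0) ∧
      BijOn ψ (connectedComponentIn (ball 0 1 \ K) 0) (ball 0 1) ∧ ψ 0 = 0 ∧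
      (∀ z ∈ connectedComponentIn (ball 0 1 \ K) 0, deriv ψ z ≠ 0) ∧
      DifferentiableOn ℂ (invFunOn ψ (connectedComponentIn (ball 0 1 \ K) 0)) (ball 0 1) := by
  set U := connectedComponentIn (ball 0 1 \ K) 0 with hU
  have hUopen : IsOpen U := (isOpen_ball.sdiff hK).connectedComponentIn
  have h0U : (0 : ℂ) ∈ U := mem_connectedComponentIn ⟨mem_ball_self one_pos, h0⟩
  have hUpc : IsPreconnected U := isPreconnected_connectedComponentIn
  have hUne : U ≠ univ := by
    intro h
    have h2 : (2 : ℂ) ∈ ball (0 : ℂ) 1 :=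
      ((connectedComponentIn_subset _ _) (h ▸ mem_univ (2 : ℂ))).1
    norm_num at h2
  have hsq : _root_.Complex.HasSqrt U :=
    _root_.Complex.hasSqrt_of_compl hUopen hUpc fun a ha ↦
      not_isBounded_connectedComponentIn_compl hK hconn ha
  exact _root_.Complex.exists_bijOn_ball_of_hasSqrt hUopen hUpc hsq hUne h0U

/-- **LSW's (2.8) for sets joined to the circle, map-free form**: for closed `K ∌ 0` with
`(ball 0 1)ᶜ ∪ K` preconnected there is a normalised Riemann map `ψ` of `U_K` (`ψ(0) = 0`,
`𝔯(K) = 1/|ψ'(0)|`) such that `𝔯(K ∪ L) = 𝔯(K) · 𝔯(ψ(L ∩ U_K))` for every `L`.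
[cite: LawlerSchrammWernerEJP2002, §2 (2.8) (p. 5)] -/
theorem exists_conformalRadius_union_eq_mul (hK : IsClosed K) (h0 : (0 : ℂ) ∉ K)
    (hconn : IsPreconnected ((ball (0 : ℂ) 1)ᶜ ∪ K)) :
    ∃ ψ : ℂ → ℂ, DifferentiableOn ℂ ψ (connectedComponentIn (ball 0 1 \ K) 0) ∧
      BijOn ψ (connectedComponentIn (ball 0 1 \ K) 0) (ball 0 1) ∧ ψ 0 = 0 ∧
      conformalRadius K = ‖deriv ψ 0‖⁻¹ ∧
      ∀ L : Set ℂ, conformalRadius (K ∪ L) =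
        conformalRadius K * conformalRadius (ψ '' (L ∩ connectedComponentIn (ball 0 1 \ K) 0)) := by
  obtain ⟨ψ, hψ, hbij, hψ0, -, hinv⟩ := exists_bijOn_connectedComponentIn hK h0 hconn
  exact ⟨ψ, hψ, hbij, hψ0, conformalRadius_eq_inv_norm_deriv hK hψ hbij hψ0 hinv,
    fun L ↦ conformalRadius_union_eq_mul hK hψ hbij hψ0 hinv L⟩

end Literature.Analysis.Complex
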